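import Literature.MathematicalPhysics.QuantumFieldTheory.Balaban1983to89.B13Lemma3AssemblyWindow
import Literature.MathematicalPhysics.QuantumFieldTheory.Balaban1983to89.B13Geometry236Printed
import Literature.MathematicalPhysics.QuantumFieldTheory.Balaban1983to89.B13Closing

/-!
# `Balaban1983to89.B13Lemma3Window` — T. Bałaban, *Renormalization group approach to lattice gauge field theories.
II. Cluster expansions*, Commun. Math. Phys. **116** (1988) 1–22 [Balaban1988RG2Cluster]: the resummation pp. 17–20
proving Lemma 3 (2.38) — `B13Lemma3Assembly.bound238With_of_226` — with EVERY geometric and combinatorial input of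
the four pages DISCHARGED on the tree's concrete two-scale model of the localization domains (the window systems
`TreeLengthCubeSystem.sys B_k`, `sys B_{k+1}` of face-connected families of cubes of ℤ⁴, d_j := `TreeLength.treeLen`,
closure map Z ↦ Z′ := `B13Geometry236.closureDom`), so that (2.38) AS PRINTED follows from the analytic input (2.26)
in its resummed form and the printed restrictions on the constants alone

statement-level skeleton of published theorems with citation tags; proofs where landed; nothing here is a claim about the Yang–Mills mass gap

PDF held: `paper:balaban1988-cmp116-rg-ii-cluster` (journal page = PDF page + 0); pp. 12–20 re-read this session from
the text layer `p0012.txt`–`p0020.txt` of that key (displays (2.26)–(2.38) are quoted verbatim in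
`…Balaban1983to89.B13Lemma3Assembly`, `…B13`, `…B13Step237`; the sentences used by THIS module are quoted below).

CITATION HEADER / WHAT IS REPRODUCED (unit `lit-balaban-r10` gen 6, B13 fold owner; SKELETON rows `B13.Lem3`,
`B13.Eq2.38`, `B13.Eq2.36`, `B13.Eq2.32`, `B13.Eq2.31`, `B13.Eq2.27` of `HOME/lit-balaban-r10/ROWS-B13.md`, HOME =
`run/shared/lean/pub/lit-balaban/`; kind «model-instance»).  The one-theorem assembly `bound238With_of_226` (gen 5,
p248665) proves (2.26) ⇒ (2.38) over ABSTRACT resummation data, every geometric / combinatorial input of pp. 17–20 an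
explicit hypothesis; gen 5's `B13Lemma3AssemblyWindow.h2732_window` discharged ONE of them ((2.27)+(2.32) at scale k)
for the window system.  HERE all the others are discharged, from theorems already in the tree:
* scale k (𝐃_k := `sys Bk`, cubes := `cellsOf Bk`): non-empty footprints; the upper half of (2.30) p. 18 *"d_k(Y) ≦
  M⁻⁴|Y| − 1"* (`TreeLength.treeLen_le_card_sub_one`); the volume law in its REPAIRED additive form |Y| ≤ 64(1 + d_k(Y))
  (`TreeLengthCubeSystem.volumeLeaf`; the printed lower half of (2.30) fails at d_k = 0, HOME GAPS G-B13-P18-01); (1.26)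
  p. 8 — the sum p. 19 invokes as *"(1.28), with κ replaced by δκ"* — at the rate δκ with the constant K₀(64, 8) of
  `B12TreeDecay` (`TreeLengthCubeSystem.ineq126_treeLen`);
  (2.29) p. 18 (`TreeLengthCubeSystem.ineq229_treeLen`, under its explicit thresholds *"for κ sufficiently large and α₆
  sufficiently small"*); (2.27)+(2.32) (`h2732_window`, kernel constant 17 for the printed 4);
* the bonds behind (2.31) and G7 p. 18 (*"The definition of Z₀ yields |P| ≧ ½M⁻⁴|Z₀∖Y₀|, because one bond in P may
  connect two cubes in Z₀∖Y₀"*; (2.3) p. 12: P ⊂ Y₀ᶜ = *"{b ∈ T₁^{(k)} : b ⊄ Y₀} ∖ {b₀(c) : c ∈ T^{(k+1)}}"*): a CONCRETE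
  bond layer — bonds ⟨y, y + e_μ⟩ of the unit lattice, the M-cube of a site y being `coarse M y` — with `touch b` = the
  ≤ 2 cubes of the endpoints and `avail Z₀ Y₀` = the bonds having an endpoint cube in Z₀∖Y₀ (⊇ the printed set:
  `mem_avail`), |avail| ≤ 8M⁴·|Z₀∖Y₀| (`card_avail_le`; print counts 4M⁴ bonds per cube);
* the transfer (2.36) p. 19 at the PRINTED ℓ = ½L for L ≥ 8 (`B13Geometry236Printed.ineq236Printed_window`), or at
  ℓ = L / a236c(L) for L ≥ 3 (`ineq236With_window_centre`);
* the anchors of pp. 19–20, verbatim: *"The last sum is estimated using (1.28), with κ replaced by δκ, and with an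
  additional sum over (L + 2)⁴ cubes □′ from π_k, the cubes touching a fixed LM-cube in Z′_i"* — `anchor Z′` := the
  π_k-cubes within sup-distance 1 of the L-block of a fixed LM-cube `base Z′ ∈ Z′`, `card_anchor_le` (≤ (L+2)⁴) and
  `hanch_window` (every Z with closure Z′ contains one of them: Z′ ∋ base Z′ = the block of a cube of Z̃);
* scale k + 1 (𝐃_{k+1} := `sys Bk1`, `closureIdx L (collar Bk) ⊆ Bk1`): the admissible Z′₀ of p. 20 *"The last sum to
  estimate is the sum over Z′₀, or over Z∖Z′₀"* over-counted by ALL non-empty Z′₀ ⊆ Z (`J Z`; p. 14: *"The sums are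
  over Z such, that each connected component of Z contains a component of Z′₀"*, so Z′₀ ≠ ∅), their components
  (`I Z j` := `B13Eq210Components.compsF`, non-empty, each a localization domain: `isDom_I`), complements `wZ`
  (injective), (2.27) per component (`TreeLengthCubeSystem.ineq227_cells`), (2.29) at the rate δℓκ (`ineq229_treeLen`),
  *"(2.32), properly adapted to the new situation"* (`B13Ineq232TreeLength.ineq232_treeLen_four` on gen 5's `compData`,
  constant 17) and the repaired volume law at scale k + 1 (`volumeLeaf`).
WHAT IS PROVED: `bound238With_window` — for two-scale window step data `TwoWindowStep Bk Bk1` (the carrier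
`B13.StepData` with 𝐃_k := `sys Bk`, 𝐃_{k+1} := `sys Bk1`; `toStepData` through `B13Closing.WindowStep`), IF the
activity is bounded on the space of p. 15 by the (2.26)-weights summed in the printed order over the CONCRETE index
sets (`hrep`, the only non-numerical hypothesis left) THEN `B13.Bound238With W.toStepData c ℓ` for every transfer
factor ℓ ≥ 0 with (2.36)_ℓ, given the printed restrictions on the constants (R15–R21, (2.31), the (2.29)/(1.26)
thresholds, R18, the absorption of the honest constants into the O(1) of C₃); `bound238_window` — the same at the
PRINTED ℓ = ½L, L ≥ 8: **(2.38) AS PRINTED `B13.Bound238 W.toStepData c`**, hence `lemma3Printed_window :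
B13.Lemma3Printed W.toStepData c`; `bound238With_window_centre` — at the kernel-certified ℓ = L / a236c(L), L ≥ 3.
No `sorry`, no new named fact (D-0026); Mathlib + the three imported modules only.

HONEST SCOPE.  (i) The analytic content of Lemma 3 — (2.15)–(2.26), i.e. the bound (2.26) for each term (2.14), and
the fact that the terms of H(Z) ARE indexed by (𝐃, P, Z₀) with Z′₀ ⊂ Z as on pp. 12–14 — stays the hypothesis `hrep`
(by assertion in print; over-counting of the index sets only weakens it).  (ii) The carrier is the free-boundary
window of ℤ⁴ of `TreeLengthCubeSystem` (the papers' cubes live on a torus; cell DIVERGENCE, unit pv11/pv22), d = 4.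
(iii) Constants are the tree's honest ones, not the printed ones, wherever print's are refuted or unspecified:
c₃₂ = 17 at both scales (print 4, `B13Ineq232Star`), volume constant 64 in the additive law (print: (2.30)),
M4 = 8M⁴ (print 4M⁴), K₁ = K₀(64, 8) and κ₀ = 64 log 162 (print: O(1) of (1.26)/(1.28), "κ sufficiently large"),
(L+2)⁴ as printed; the located slips are carried exactly as in `B13Lemma3Assembly` (HONEST SCOPE there).  (iv) The
block size of the geometry IS the constant `c.L` of `B13.Consts` (the (L+2)⁴ of the anchors meets the (L+2)⁴ of
`B13Step237.memberF`).  Value = kernel-checked bookkeeping: after this module the window-model Lemma 3 rests on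
(2.26) and numbers only.
-/

namespace Literature.MathematicalPhysics.QuantumFieldTheory.Balaban1983to89.B13Lemma3Window

open Literature.MathematicalPhysics.QuantumFieldTheory.Balaban1983to89
open Literature.MathematicalPhysics.QuantumFieldTheory.Balaban1983to89.B13ScaleTransfer
  (Pt Adj FaceConnected block mem_block collar subset_collar coarse coarse_eq_iff closureIdx)
open Literature.MathematicalPhysics.QuantumFieldTheory.Balaban1983to89.TreeLength (treeLen treeLen_nonneg)
open Literature.MathematicalPhysics.QuantumFieldTheory.Balaban1983to89.TreeLengthCubeSystem
  (IsDom Dom sys Cell cellsOf mem_cellsOf card_cellsOf cellsOf_inj cubeSys ineq227_cells)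
open Literature.MathematicalPhysics.QuantumFieldTheory.Balaban1983to89.B12TreeDecay (kappa₀ K₀ K₀_pos)
open Literature.MathematicalPhysics.QuantumFieldTheory.Balaban1983to89.B13Geometry236 (closureDom closureDom_val)
open Literature.MathematicalPhysics.QuantumFieldTheory.Balaban1983to89.B13Geometry236Printed (a236c a236c_pos)
open Literature.MathematicalPhysics.QuantumFieldTheory.Balaban1983to89.B13Eq210Components
  (compF compsF mem_compsF compF_subset isDom_compF)
open Literature.MathematicalPhysics.QuantumFieldTheory.Balaban1983to89.B13Lemma3Assembly (innerSum compSum famSum)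

noncomputable section

variable {d : ℕ}

/-! ## §1. Scale-k inputs of the window system: footprints, (2.30) upper half, volume law, (1.26) -/

/-- Non-empty footprints: a localization domain is a NON-EMPTY family of cubes ([Balaban1987RG1] p. 257); the
hypothesis `hne` of `B13Lemma3Assembly.bound238With_of_226`. [cite: Balaban1987RG1, §0 p.257] -/
theorem cellsOf_nonempty {B : Finset (Pt d)} (Y : Dom B) : (cellsOf B Y.1).Nonempty := by
  obtain ⟨x, hx⟩ := Y.2.2.1
  exact ⟨⟨x, Y.2.1 hx⟩, mem_cellsOf.2 hx⟩

/-- `cellsOf B X` has at most |X| elements (X need not lie inside the window); private plumbing. [folklore] -/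
private theorem card_cellsOf_le (B X : Finset (Pt d)) : (cellsOf B X).card ≤ X.card := by
  classical
  calc (cellsOf B X).card = ((cellsOf B X).image Subtype.val).card :=
        (Finset.card_image_of_injective _ Subtype.val_injective).symm
    _ ≤ X.card := Finset.card_le_card fun x hx => by
        obtain ⟨c, hc, rfl⟩ := Finset.mem_image.1 hx
        exact mem_cellsOf.1 hc

/-- (2.30) p. 18, upper half, verbatim: *"d_k(Y) ≦ M⁻⁴|Y| − 1 (2.30) holding for localization domains Y ∈ 𝐃_k"* — for
`treeLen` on the window system (`TreeLength.treeLen_le_card_sub_one`), in the shape `d_k(Z₀) + 1 ≤ |cubes Z₀|` of the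
hypothesis `h230` of `bound238With_of_226`. [cite: Balaban1988RG2Cluster, (2.30) p.18] -/
theorem h230_window {B : Finset (Pt d)} (Zc : Dom B) : treeLen Zc.1 + 1 ≤ ((cellsOf B Zc.1).card : ℝ) := by
  rw [card_cellsOf Zc.2.1]
  have h := TreeLength.treeLen_le_card_sub_one Zc.2.2.1 Zc.2.2.2
  linarith

/-- The volume law in its REPAIRED additive form `|Y| ≤ 4·2^d (1 + d_k(Y))` for every domain of the window
(`TreeLengthCubeSystem.volumeLeaf` through `B12TreeDecay.familySum_volBound_iff`) — the shape `B13FamilySum.VolBound`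
of the hypothesis `hvol`; print uses the lower half of (2.30), false at d_k(Y) = 0 (HOME GAPS G-B13-P18-01). [cite: Balaban1988RG2Cluster, (2.30) p.18] -/
theorem hvol_window (B : Finset (Pt d)) :
    B13FamilySum.VolBound (Finset.univ : Finset (Dom B)) (fun Y : Dom B => cellsOf B Y.1) (sys B).dj (4 * 2 ^ d) :=
  (B12TreeDecay.familySum_volBound_iff (cubeSys B) _).2 (TreeLengthCubeSystem.volumeLeaf B)

/-- (1.26) p. 8, *"Σ_{X∈𝐃_j, X⊃□′} exp(−κd_j(X)) ≦ O(1) (1.26) for κ sufficiently large"* — the sum p. 19 invokes as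
*"(1.28), with κ replaced by δκ"*: for every rate r ≥ κ₀(4·2^d, 2d) and every cube □′ of the window,
Σ_{X ∋ □′} e^{−r d(X)} ≤ K₀(4·2^d, 2d) (`TreeLengthCubeSystem.ineq126_treeLen` through `B12TreeDecay.familySum_ineq126_iff`)
— the shape `B13FamilySum.Ineq126` of the hypothesis `h126`. [cite: Balaban1988RG2Cluster, (1.26) p.8] -/
theorem h126_window (B : Finset (Pt d)) {r : ℝ} (hr : kappa₀ (4 * 2 ^ d) (2 * d) ≤ r) :
    B13FamilySum.Ineq126 (Finset.univ : Finset (Dom B)) (fun Y : Dom B => cellsOf B Y.1) (sys B).dj r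
      (K₀ (4 * 2 ^ d) (2 * d)) :=
  (B12TreeDecay.familySum_ineq126_iff (cubeSys B) _ _).2 (TreeLengthCubeSystem.ineq126_treeLen B hr)

/-! ## §2. The anchors of pp. 19–20: (L+2)^d cubes of π_k attached to a fixed LM-cube of Z′ -/

/-- The π_k-cubes within sup-distance 1 of the L-block of index b (the block = {y : Lb_i ≤ y_i < L(b_i + 1)},
`B13ScaleTransfer.coarse_eq_iff`): those of index y with Lb_i − 1 ≤ y_i ≤ Lb_i + L — p. 20's *"cubes □′ from π_k …
touching a fixed LM-cube"*, (L+2)^d of them. [cite: Balaban1988RG2Cluster, p.20 l.1 (the (L+2)⁴ cubes)] -/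
def anchorBox (L : ℕ) (b : Pt d) : Finset (Pt d) :=
  Fintype.piFinset fun i => Finset.Icc ((L : ℤ) * b i - 1) ((L : ℤ) * b i + L)

/-- Membership in `anchorBox`; private plumbing. [folklore] -/
private theorem mem_anchorBox {L : ℕ} {b y : Pt d} :
    y ∈ anchorBox L b ↔ ∀ i, (L : ℤ) * b i - 1 ≤ y i ∧ y i ≤ (L : ℤ) * b i + L := by
  simp [anchorBox, Fintype.mem_piFinset, Finset.mem_Icc]

/-- `anchorBox L b` consists of exactly (L+2)^d cubes (p. 20: *"(L + 2)⁴ cubes"*). [cite: Balaban1988RG2Cluster, p.20 l.1 (the (L+2)⁴ cubes)] -/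
theorem card_anchorBox (L : ℕ) (b : Pt d) : (anchorBox L b).card = (L + 2) ^ d := by
  rw [anchorBox, Fintype.card_piFinset]
  have h : ∀ i : Fin d, (Finset.Icc ((L : ℤ) * b i - 1) ((L : ℤ) * b i + L)).card = L + 2 := by
    intro i
    rw [Int.card_Icc]
    have : (L : ℤ) * b i + L + 1 - ((L : ℤ) * b i - 1) = (L : ℤ) + 2 := by ring
    rw [this]
    omega
  simp [h, Finset.prod_const, Finset.card_univ, Fintype.card_fin]

/-- *"a fixed LM-cube in Z′_i"* (p. 20): a chosen cube of the (non-empty) domain Z′. [cite: Balaban1988RG2Cluster, p.20 l.1 (a fixed LM-cube in Z′)] -/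
def base {B : Finset (Pt d)} (Z' : Dom B) : Pt d := Z'.2.2.1.choose

/-- The chosen cube lies in Z′; private plumbing. [folklore] -/
private theorem base_mem {B : Finset (Pt d)} (Z' : Dom B) : base Z' ∈ Z'.1 := Z'.2.2.1.choose_spec

/-- The anchors of Z′ ∈ 𝐃_{k+1}: the cubes of the scale-k window within sup-distance 1 of the L-block of the fixed
LM-cube `base Z′` — pp. 19–20, verbatim: *"with an additional sum over (L + 2)⁴ cubes □′ from π_k, the cubes touching a
fixed LM-cube in Z′_i"*. [cite: Balaban1988RG2Cluster, pp.19–20 (the anchored (1.28)-sum)] -/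
def anchor (L : ℕ) (Bk : Finset (Pt d)) {Bk1 : Finset (Pt d)} (Z' : Dom Bk1) : Finset (Cell Bk) :=
  cellsOf Bk (anchorBox L (base Z'))

/-- There are at most (L+2)^d anchors — the hypothesis `hLfac` of `bound238With_of_226` (d = 4: (L+2)⁴ as printed).
[cite: Balaban1988RG2Cluster, p.20 l.1 (the (L+2)⁴ cubes)] -/
theorem card_anchor_le (L : ℕ) (Bk : Finset (Pt d)) {Bk1 : Finset (Pt d)} (Z' : Dom Bk1) :
    ((anchor L Bk Z').card : ℝ) ≤ ((L : ℝ) + 2) ^ d := by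
  have h := (card_cellsOf_le Bk (anchorBox L (base Z'))).trans (card_anchorBox L (base Z')).le
  exact_mod_cast h

/-- **Every Z ∈ 𝐃_k whose closure is Z′ contains an anchor of Z′** — the hypothesis `hanch` of
`bound238With_of_226` for the closure map Z ↦ Z′ = `closureDom` (Z′ = the LM-cubes met by Z̃, p. 19 *"we denote by Z′_i
the smallest localization domain from 𝐃_{k+1} containing Z̃_i"*): the fixed LM-cube of Z′ is the block of a cube x of
Z̃ = `collar Z`, x lies in the □̃ of a cube y of Z, and then y is within sup-distance 1 of that block.  This is why the
anchored (1.28)-sum of p. 19 runs over cubes *"touching a fixed LM-cube in Z′_i"*. [cite: Balaban1988RG2Cluster, pp.19–20 (the anchored (1.28)-sum)] -/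
theorem hanch_window {L : ℕ} (hL : 0 < L) {Bk Bk1 : Finset (Pt d)} (hB : closureIdx L (collar Bk) ⊆ Bk1)
    (Zc : Dom Bk) : ∃ q ∈ anchor L Bk (closureDom hL hB Zc), q ∈ cellsOf Bk Zc.1 := by
  set Z' := closureDom hL hB Zc with hZ'
  have hb : base Z' ∈ closureIdx L (collar Zc.1) := by
    have := base_mem Z'
    rwa [hZ', closureDom_val] at this
  obtain ⟨x, hx, hxb⟩ := Finset.mem_image.1 hb
  obtain ⟨y, hy, hxy⟩ := Finset.mem_biUnion.1 hx
  have hcoarse := (coarse_eq_iff hL x (base Z')).1 hxb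
  have hblock := mem_block.1 hxy
  refine ⟨⟨y, Zc.2.1 hy⟩, mem_cellsOf.2 (mem_anchorBox.2 fun i => ?_), mem_cellsOf.2 hy⟩
  obtain ⟨h1, h2⟩ := hcoarse i
  obtain ⟨h3, h4⟩ := hblock i
  constructor <;> linarith

/-! ## §3. The bond layer behind G7 and (2.31) p. 18: bonds of the unit lattice T₁^{(k)} and the cubes they touch -/

/-- A bond of the unit lattice as (initial site, direction): ⟨y, y + e_μ⟩ ((2.3) p. 12: *"the set of bonds Y₀ᶜ =
{b ∈ T₁^{(k)} : b ⊄ Y₀} ∖ {b₀(c) : c ∈ T^{(k+1)}} … Here the symbol |P| means the number of bonds in the set P"*).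
Index device only (the bond VARIABLES B(b) are `B13.StepData.Bond`/`Bv`). [cite: Balaban1988RG2Cluster, (2.3) p.12] -/
abbrev LBond (d : ℕ) : Type := Pt d × Fin d

/-- The end site y + e_μ of the bond ⟨y, y + e_μ⟩. [folklore] -/
def bondEnd (b : LBond d) : Pt d := Function.update b.1 b.2 (b.1 b.2 + 1)

/-- The cubes of the scale-k window met by a bond: the M-cubes of its two endpoints (the M-cube of a site y has index
`coarse M y`, i.e. {y : Mx_i ≤ y_i < M(x_i + 1)}) — p. 18: *"one bond in P may connect two cubes in Z₀∖Y₀"*.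
[cite: Balaban1988RG2Cluster, p.18 (before (2.31))] -/
def touch (M : ℕ) (Bk : Finset (Pt d)) (b : LBond d) : Finset (Cell Bk) :=
  cellsOf Bk ({coarse M b.1, coarse M (bondEnd b)} : Finset (Pt d))

/-- A bond meets at most two cubes (p. 18: *"one bond in P may connect two cubes"*) — the hypothesis `htouch` of
`bound238With_of_226` (G7, `B13MayerDecoupling.card_le_two_mul_card_of_cover`). [cite: Balaban1988RG2Cluster, p.18 (before (2.31))] -/
theorem card_touch_le (M : ℕ) (Bk : Finset (Pt d)) (b : LBond d) : (touch M Bk b).card ≤ 2 :=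
  (card_cellsOf_le Bk _).trans Finset.card_le_two

/-- The M^d sites of the M-cube of index x: {y : Mx_i ≤ y_i < Mx_i + M}. [cite: Balaban1987RG1, §0 p.257] -/
def sites (M : ℕ) (x : Pt d) : Finset (Pt d) :=
  Fintype.piFinset fun i => Finset.Ico ((M : ℤ) * x i) ((M : ℤ) * x i + M)

/-- A site belongs to `sites M x` iff its M-cube is x (`B13ScaleTransfer.coarse_eq_iff`); private plumbing. [folklore] -/
private theorem mem_sites {M : ℕ} (hM : 0 < M) {x y : Pt d} : y ∈ sites M x ↔ coarse M y = x := by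
  rw [coarse_eq_iff hM]
  simp only [sites, Fintype.mem_piFinset, Finset.mem_Ico]
  constructor
  · intro h i
    obtain ⟨h1, h2⟩ := h i
    exact ⟨h1, by linarith⟩
  · intro h i
    obtain ⟨h1, h2⟩ := h i
    exact ⟨h1, by linarith⟩

/-- An M-cube has M^d sites (|□| = M^d, the printed M⁴ at d = 4). [cite: Balaban1987RG1, §0 p.257] -/
theorem card_sites (M : ℕ) (x : Pt d) : (sites M x).card = M ^ d := by
  rw [sites, Fintype.card_piFinset]
  have h : ∀ i : Fin d, (Finset.Ico ((M : ℤ) * x i) ((M : ℤ) * x i + M)).card = M := by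
    intro i
    rw [Int.card_Ico]
    have : (M : ℤ) * x i + M - (M : ℤ) * x i = (M : ℤ) := by ring
    rw [this]
    exact Int.toNat_natCast M
  simp [h, Finset.prod_const, Finset.card_univ, Fintype.card_fin]

/-- The bonds meeting the M-cube x: those starting at a site of x and those ending at a site of x (p. 18 counts
*"4M⁴"* bonds per cube in (2.31), i.e. d·M^d, each bond once; here each bond is listed at both endpoint cubes).
[cite: Balaban1988RG2Cluster, (2.31) p.18] -/
def bondsAt (M : ℕ) (x : Pt d) : Finset (LBond d) :=
  (sites M x ×ˢ (Finset.univ : Finset (Fin d))) ∪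
    ((sites M x ×ˢ (Finset.univ : Finset (Fin d))).image fun b => (Function.update b.1 b.2 (b.1 b.2 - 1), b.2))

/-- At most 2d·M^d bonds meet a cube (d = 4: 8M⁴; print's count per cube is 4M⁴). [cite: Balaban1988RG2Cluster, (2.31) p.18] -/
theorem card_bondsAt_le (M : ℕ) (x : Pt d) : (bondsAt M x).card ≤ 2 * d * M ^ d := by
  have hprod : (sites M x ×ˢ (Finset.univ : Finset (Fin d))).card = M ^ d * d := by
    rw [Finset.card_product, card_sites, Finset.card_univ, Fintype.card_fin]
  calc (bondsAt M x).card ≤ (sites M x ×ˢ (Finset.univ : Finset (Fin d))).card +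
        ((sites M x ×ˢ (Finset.univ : Finset (Fin d))).image
          fun b => (Function.update b.1 b.2 (b.1 b.2 - 1), b.2)).card := Finset.card_union_le _ _
    _ ≤ (sites M x ×ˢ (Finset.univ : Finset (Fin d))).card +
        (sites M x ×ˢ (Finset.univ : Finset (Fin d))).card :=
          Nat.add_le_add_left Finset.card_image_le _
    _ = 2 * d * M ^ d := by rw [hprod]; ring

/-- A bond starting in the cube x meets x; private plumbing. [folklore] -/
private theorem mem_bondsAt_of_start {M : ℕ} (hM : 0 < M) {x : Pt d} {b : LBond d} (h : coarse M b.1 = x) :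
    b ∈ bondsAt M x :=
  Finset.mem_union_left _ (Finset.mem_product.2 ⟨(mem_sites hM).2 h, Finset.mem_univ _⟩)

/-- A bond ending in the cube x meets x; private plumbing. [folklore] -/
private theorem mem_bondsAt_of_end {M : ℕ} (hM : 0 < M) {x : Pt d} {b : LBond d} (h : coarse M (bondEnd b) = x) :
    b ∈ bondsAt M x := by
  refine Finset.mem_union_right _ (Finset.mem_image.2 ⟨(bondEnd b, b.2), ?_, ?_⟩)
  · exact Finset.mem_product.2 ⟨(mem_sites hM).2 h, Finset.mem_univ _⟩
  · obtain ⟨y, μ⟩ := b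
    simp only [bondEnd, Function.update_self, Function.update_idem, add_sub_cancel_right,
      Function.update_eq_self]

/-- The bonds AVAILABLE to the large-field set P of a term (2.14) at fixed component Z₀ and fixed Y₀: all bonds meeting
a cube of Z₀∖Y₀ — p. 12 *"For a given set P we take the smallest localization domain Z₀ ∈ 𝐃_k containing Y₀ and P"*
read with p. 18 *"The definition of Z₀ yields |P| ≧ ½M⁻⁴|Z₀∖Y₀|"* (cell transcript G7: Z₀ = Y₀ ∪ {cubes meeting bonds
of P}); an over-count of the printed P ⊂ Y₀ᶜ inside Z₀ (`mem_avail`), which only enlarges the majorant.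
[cite: Balaban1988RG2Cluster, p.12 (before (2.4)) and p.18 (before (2.31))] -/
def avail (M : ℕ) (Bk : Finset (Pt d)) (Zc : Dom Bk) (Y₀ : Finset (Cell Bk)) : Finset (LBond d) :=
  (cellsOf Bk Zc.1 \ Y₀).biUnion fun q => bondsAt M q.1

/-- **The bond count behind (2.31)**: |avail Z₀ Y₀| ≤ 2d·M^d·|Z₀∖Y₀| (d = 4: 8M⁴ per cube of Z₀∖Y₀; print: *"4M⁴"*) —
the hypothesis `havail` of `bound238With_of_226` (`B13MayerDecoupling.sum_P_bound_231`). [cite: Balaban1988RG2Cluster, (2.31) p.18] -/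
theorem card_avail_le (M : ℕ) (Bk : Finset (Pt d)) (Zc : Dom Bk) (Y₀ : Finset (Cell Bk)) :
    ((avail M Bk Zc Y₀).card : ℝ) ≤ (2 * d * M ^ d : ℝ) * ((cellsOf Bk Zc.1 \ Y₀).card : ℝ) := by
  have h : (avail M Bk Zc Y₀).card ≤ (cellsOf Bk Zc.1 \ Y₀).card * (2 * d * M ^ d) := by
    calc (avail M Bk Zc Y₀).card ≤ ∑ q ∈ cellsOf Bk Zc.1 \ Y₀, (bondsAt M q.1).card := Finset.card_biUnion_le
      _ ≤ ∑ q ∈ cellsOf Bk Zc.1 \ Y₀, 2 * d * M ^ d := Finset.sum_le_sum fun q _ => card_bondsAt_le M q.1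
      _ = (cellsOf Bk Zc.1 \ Y₀).card * (2 * d * M ^ d) := by rw [Finset.sum_const, smul_eq_mul]
  have h' : ((avail M Bk Zc Y₀).card : ℝ) ≤ ((cellsOf Bk Zc.1 \ Y₀).card : ℝ) * (2 * d * M ^ d : ℝ) := by
    exact_mod_cast h
  linarith [h']

/-- Faithfulness of the over-count: a bond lying in Z₀ (both endpoint cubes in Z₀) and not inside Y₀ (an endpoint cube
outside Y₀) — every bond of the printed P ⊂ Y₀ᶜ ∩ Z₀ of pp. 12, 18 — is available. [cite: Balaban1988RG2Cluster, p.12 (before (2.4)) and p.18 (before (2.31))] -/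
theorem mem_avail {M : ℕ} (hM : 0 < M) {Bk : Finset (Pt d)} (Zc : Dom Bk) (Y₀ : Finset (Cell Bk)) {b : LBond d}
    (hsub : touch M Bk b ⊆ cellsOf Bk Zc.1) (hnot : ¬ touch M Bk b ⊆ Y₀) : b ∈ avail M Bk Zc Y₀ := by
  classical
  rw [avail, Finset.mem_biUnion]
  obtain ⟨q, hq, hqY⟩ := Finset.not_subset.1 hnot
  refine ⟨q, Finset.mem_sdiff.2 ⟨hsub hq, hqY⟩, ?_⟩
  have hq' := mem_cellsOf.1 hq
  rcases Finset.mem_insert.1 hq' with h | h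
  · exact mem_bondsAt_of_start hM h.symm
  · exact mem_bondsAt_of_end hM (Finset.mem_singleton.1 h).symm

/-! ## §4. Scale-(k+1) index data: the admissible Z′₀ ⊆ Z, their components Z′_i, the complements Z∖Z′₀ -/

/-- The admissible Z′₀ of a localization domain Z ∈ 𝐃_{k+1}, OVER-COUNTED by all non-empty families Z′₀ ⊆ Z of
LM-cubes — p. 20 *"The last sum to estimate is the sum over Z′₀, or over Z∖Z′₀"*; p. 14 *"The sums are over Z such,
that each connected component of Z contains a component of Z′₀"* (so Z′₀ ∩ Z ≠ ∅ for the terms of H(Z), (2.9)).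
The index type `J Z` of `B13Bound238Assembly` / `bound238With_of_226`. [cite: Balaban1988RG2Cluster, (2.9) p.14 and p.20 (the sum over Z′₀)] -/
def J {Bk1 : Finset (Pt d)} (Z : Dom Bk1) : Type := {Z₀' : Finset (Pt d) // Z₀' ⊆ Z.1 ∧ Z₀'.Nonempty}

/-- The admissible Z′₀ form a finite type. [folklore] -/
instance instFintypeJ {Bk1 : Finset (Pt d)} (Z : Dom Bk1) : Fintype (J Z) :=
  Fintype.subtype (Z.1.powerset.filter fun Z₀' => Z₀'.Nonempty) fun Z₀' => by
    simp only [Finset.mem_filter, Finset.mem_powerset]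

/-- The connected components Z′_i of Z′₀ (p. 20: *"where now Z′_i denote connected components of Z′₀"*; p. 19: *"the
set Z′₀ is a union of connected components, which are localization domains from 𝐃_{k+1}"*), as the finite type of the
members of `B13Eq210Components.compsF Z′₀` — the index type `I Z j`. [cite: Balaban1988RG2Cluster, p.19–20 (components of Z′₀)] -/
def I {Bk1 : Finset (Pt d)} (Z : Dom Bk1) (j : J Z) : Type := {K : Finset (Pt d) // K ∈ compsF j.1}

/-- The components form a finite type. [folklore] -/
instance instFintypeI {Bk1 : Finset (Pt d)} (Z : Dom Bk1) (j : J Z) : Fintype (I Z j) :=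
  Fintype.subtype (compsF j.1) fun _ => Iff.rfl

/-- A non-empty Z′₀ has at least one component (the component of any of its cubes). [folklore] -/
instance instNonemptyI {Bk1 : Finset (Pt d)} (Z : Dom Bk1) (j : J Z) : Nonempty (I Z j) := by
  obtain ⟨a, ha⟩ := j.2.2
  exact ⟨⟨compF j.1 a, mem_compsF.2 ⟨a, ha, rfl⟩⟩⟩

/-- Each component Z′_i is a localization domain of the scale-(k+1) window (p. 19: *"which are localization domains
from 𝐃_{k+1}"*; `B13Eq210Components.isDom_compF`). [cite: Balaban1988RG2Cluster, p.19 (components are localization domains)] -/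
theorem isDom_I {Bk1 : Finset (Pt d)} (Z : Dom Bk1) (j : J Z) (i : I Z j) : IsDom Bk1 i.1 := by
  obtain ⟨a, ha, h⟩ := mem_compsF.1 i.2
  rw [← h]
  exact isDom_compF (j.2.1.trans Z.2.1) ha

/-- d_{k+1}(Z′_i) := `treeLen` of the component (the `dI` of `B13Bound238Assembly`). [cite: Balaban1988RG2Cluster, (2.37) p.20] -/
def dI {Bk1 : Finset (Pt d)} (Z : Dom Bk1) (j : J Z) (i : I Z j) : ℝ := treeLen i.1

/-- The LM-cubes of the component Z′_i, as cubes of the scale-(k+1) window (the `cc` of `bound238With_of_226`).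
[cite: Balaban1988RG2Cluster, (2.37) p.20] -/
def cc {Bk1 : Finset (Pt d)} (Z : Dom Bk1) (j : J Z) (i : I Z j) : Finset (Cell Bk1) := cellsOf Bk1 i.1

/-- The LM-cubes of Z∖Z′₀ (p. 20: *"the sum over Z′₀, or over Z∖Z′₀"*; their number is the printed (LM)⁻⁴|Z∖Z′₀| of
(2.26)/(2.35)/(2.37)) — the `w` of `B13Bound238Assembly`. [cite: Balaban1988RG2Cluster, p.20 (the sum over Z∖Z′₀)] -/
def wZ {Bk1 : Finset (Pt d)} (Z : Dom Bk1) (j : J Z) : Finset (Cell Bk1) := cellsOf Bk1 (Z.1 \ j.1)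

/-- Z′₀ ⊆ Z is determined by Z∖Z′₀ — p. 20: *"the sum over Z′₀, or over Z∖Z′₀"* — i.e. `wZ Z` is injective (the
hypothesis `hw` of `bound238With_of_226`). [cite: Balaban1988RG2Cluster, p.20 (the sum over Z∖Z′₀)] -/
theorem wZ_injective {Bk1 : Finset (Pt d)} (Z : Dom Bk1) : Function.Injective (wZ Z) := by
  intro j j' h
  have h1 : Z.1 \ j.1 = Z.1 \ j'.1 :=
    cellsOf_inj (Finset.sdiff_subset.trans Z.2.1) (Finset.sdiff_subset.trans Z.2.1) h
  apply Subtype.ext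
  have hj : j.1 = Z.1 \ (Z.1 \ j.1) := (Finset.sdiff_sdiff_eq_self j.2.1).symm
  have hj' : j'.1 = Z.1 \ (Z.1 \ j'.1) := (Finset.sdiff_sdiff_eq_self j'.2.1).symm
  rw [hj, hj', h1]

/-- The cubes of Z∖Z′₀ are cubes of Z (p. 20: *"the sum over Z′₀, or over Z∖Z′₀"*, Z′₀ ⊂ Z; the hypothesis `hws`).
[cite: Balaban1988RG2Cluster, p.20 (the sum over Z∖Z′₀)] -/
theorem wZ_subset {Bk1 : Finset (Pt d)} (Z : Dom Bk1) (j : J Z) : wZ Z j ⊆ cellsOf Bk1 Z.1 :=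
  fun _ hc => mem_cellsOf.2 (Finset.sdiff_subset (mem_cellsOf.1 hc))

/-- The components Z′_i are non-empty families of LM-cubes (p. 19: they *"are localization domains from 𝐃_{k+1}"*;
the hypothesis `hcc`). [cite: Balaban1988RG2Cluster, p.19 (components are localization domains)] -/
theorem cc_nonempty {Bk1 : Finset (Pt d)} (Z : Dom Bk1) (j : J Z) (i : I Z j) : (cc Z j i).Nonempty :=
  cellsOf_nonempty ⟨i.1, isDom_I Z j i⟩

/-- **(2.27) at scale k + 1 for each component Z′_i** (p. 20: *"The inequality (2.27) is used for the remaining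
exponential factors"*): for every family of 𝐃_{k+1}-domains whose cubes cover exactly Z′_i, d_{k+1}(Z′_i) + 5 ≤
Σ (d_{k+1}(Z′) + 5) — `TreeLengthCubeSystem.ineq227_cells` (from `TreeLength.ineq227_treeLen`), the hypothesis `h227'`.
[cite: Balaban1988RG2Cluster, (2.27) p.18 (used at scale k+1, p.20)] -/
theorem h227'_window {Bk1 : Finset (Pt d)} (Z : Dom Bk1) (j : J Z) (i : I Z j) :
    B13FamilySum.Ineq227 (Finset.univ : Finset (Dom Bk1)) (fun Y : Dom Bk1 => cellsOf Bk1 Y.1) (sys Bk1).dj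
      (cc Z j i) (dI Z j i) 5 :=
  ineq227_cells Bk1 ⟨i.1, isDom_I Z j i⟩

/-- The repaired volume law at scale k + 1, `(LM)⁻⁴|Z| ≤ 4·2^d (1 + d_{k+1}(Z))` (`TreeLengthCubeSystem.volumeLeaf`) —
the hypothesis `hvol1` (print: *"We use the factor exp(−δ½Lκd_{k+1}(Z)), and the inequality (2.30), to bound the
exponentials by 1"*, p. 20; the multiplicative (2.30) fails at d_{k+1}(Z) = 0, HOME GAPS G-B13-P18-01). [cite: Balaban1988RG2Cluster, (2.30) p.18 (used at scale k+1, p.20)] -/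
theorem hvol1_window {Bk1 : Finset (Pt d)} (Z : Dom Bk1) :
    ((cellsOf Bk1 Z.1).card : ℝ) ≤ 4 * 2 ^ d * (1 + treeLen Z.1) := by
  have h := TreeLengthCubeSystem.volumeLeaf Bk1 Z
  rwa [TreeLengthCubeSystem.cubeSys_vol, TreeLengthCubeSystem.sys_dj, ← card_cellsOf Z.2.1] at h

/-- **(2.32) "properly adapted to the new situation"** (p. 20, verbatim: *"Using the inequality (2.32), properly adapted
to the new situation, we bound the exponential factors in the square bracket above, and half of the first exponential
factor, by exp(−(1 − 7δ)½Lκd_{k+1}(Z))"*) — at scale k + 1, for the connected Z ⊇ Z′₀ ≠ ∅ with the components Z′_i of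
Z′₀: d_{k+1}(Z) ≤ Σ_i d_{k+1}(Z′_i) + 17·(LM)⁻⁴|Z∖Z′₀| (kernel constant 17 for the printed 4, d = 4), by
`B13Ineq232TreeLength.ineq232_treeLen_four` on the datum `B13Lemma3AssemblyWindow.compData Z Z′₀` — the hypothesis
`h232`. [cite: Balaban1988RG2Cluster, (2.32) p.18 (adapted at scale k+1, p.20)] -/
theorem h232_window {Bk1 : Finset (Pt 4)} (Z : Dom Bk1) (j : J Z) :
    treeLen Z.1 ≤ ∑ i : I Z j, dI Z j i + 17 * ((wZ Z j).card : ℝ) := by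
  classical
  set CD := B13Lemma3AssemblyWindow.compData Z.1 j.1 Z.2.2.2 j.2.1 with hCD
  have hne : CD.parts.Nonempty := by
    obtain ⟨a, ha⟩ := j.2.2
    exact ⟨compF j.1 a, mem_compsF.2 ⟨a, ha, rfl⟩⟩
  have h232 := B13Ineq232TreeLength.ineq232_treeLen_four CD hne
  have hW : (CD.W.card : ℝ) = ((wZ Z j).card : ℝ) := by
    rw [hCD, B13Lemma3AssemblyWindow.compData_W, wZ, card_cellsOf (Finset.sdiff_subset.trans Z.2.1)]
  have hsum : ∑ P ∈ CD.parts, treeLen P = ∑ i : I Z j, dI Z j i := by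
    show ∑ P ∈ compsF j.1, treeLen P = ∑ i : I Z j, treeLen i.1
    rw [← Finset.sum_coe_sort]
    rfl
  rw [hW, hsum] at h232
  exact h232

/-! ## §5. Two-scale window step data; Lemma 3's resummation with every geometric input discharged -/

/-- STEP DATA OVER TWO WINDOWS: the carrier `B13.StepData` with BOTH systems of localization domains fixed to be the
concrete window systems of `TreeLengthCubeSystem` — 𝐃_k := `sys Bk` (M-cubes of the window `Bk ⊂ ℤ^d`), 𝐃_{k+1} :=
`sys Bk1` (LM-cubes, window `Bk1 ⊇ (B̃k)′`), d_j := `treeLen`; all other fields verbatim those of `B13.StepData`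
(configurations, bond variables, V′_k, V_k, Q, V″_k, the activity H(Z), E^{(k+1)}, the log Z^{(k)} terms, the reader-owned
predicates, the restrictions) — cf. `B13Closing.WindowStep` (𝐃_{k+1} only). [cite: Balaban1988RG2Cluster, (1.1)–(2.13) pp.3–14 (carrier)] -/
structure TwoWindowStep (Bk Bk1 : Finset (Pt d)) where
  volk : (sys Bk).Dom → ℕ
  Φ : Type
  Bond : Type
  [finBond : Fintype Bond]
  sp1 : (sys Bk).Dom → Set Φ
  sp2 : (sys Bk1).Dom → Set Φ
  Bv : Φ → Bond → ℂ
  Vp : (sys Bk).Dom → Φ → ℂ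
  V : (sys Bk).Dom → Φ → ℂ
  Q : (sys Bk).Dom → Φ → Bond → Bond → ℂ
  Vpp : (sys Bk).Dom → Φ → ℂ
  H : (sys Bk1).Dom → Φ → ℂ
  Ek1 : (sys Bk1).Dom → Φ → ℂ
  Elog : (sys Bk1).Dom → Φ → ℂ
  Analytic : (Φ → ℂ) → Set Φ → Prop
  GaugeInv : (Φ → ℂ) → Prop
  Repr17 : Prop
  Restr : Prop

namespace TwoWindowStep

variable {Bk Bk1 : Finset (Pt d)}

/-- Two-window step data as window step data of `B13Closing` (𝐃_k := `sys Bk`), so that `B13Closing.deliverables_window`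
applies to it. [folklore] -/
def toWindowStep (W : TwoWindowStep Bk Bk1) : B13Closing.WindowStep Bk1 where
  Dk := sys Bk
  volk := W.volk
  Φ := W.Φ
  Bond := W.Bond
  finBond := W.finBond
  sp1 := W.sp1
  sp2 := W.sp2
  Bv := W.Bv
  Vp := W.Vp
  V := W.V
  Q := W.Q
  Vpp := W.Vpp
  H := W.H
  Ek1 := W.Ek1
  Elog := W.Elog
  Analytic := W.Analytic
  GaugeInv := W.GaugeInv
  Repr17 := W.Repr17
  Restr := W.Restr

/-- Two-window step data as abstract step data (`Dk := sys Bk`, `Dk1 := sys Bk1`). [folklore] -/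
abbrev toStepData (W : TwoWindowStep Bk Bk1) : B13.StepData := W.toWindowStep.toStepData

end TwoWindowStep

open Classical in
/-- **Lemma 3's resummation on the two-scale window model: (2.26) ⇒ (2.38)_ℓ with every geometric / combinatorial
input DISCHARGED** (pp. 17–20 [17–20]; p. 17, verbatim: *"To get a bound for H(Z) we have to perform the resummation of
the terms (2.14) over 𝐃, P and Z₀. We do it in the following order. For a fixed Y₀ we sum over all 𝐃 satisfying (2.2).
Next, we sum over Y₀, P determining a fixed Z₀. Further, for a fixed Z′₀, we sum over all possible Z₀ determining this
fixed Z′₀. Finally we sum over all Z′₀ ⊂ Z."*).  For two-window step data (𝐃_k := `sys Bk`, 𝐃_{k+1} := `sys Bk1`,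
`closureIdx L (collar Bk) ⊆ Bk1`, L = `c.L`, d = 4), a cube size M and a transfer factor ℓ ≥ 0 with (2.36)_ℓ
(`B13.Ineq236With … (closureDom …) ℓ`): IF on the space of p. 15 `‖H(Z)‖ ≤ e^{a₅|Z|} Σ_{Z′₀ ⊆ Z, Z′₀ ≠ ∅}
e^{−(κ₁−1)|Z∖Z′₀|} Π_{components Z′_i of Z′₀} famSum_{families of 𝐃_{k+1}-domains covering Z′_i} Π_{Z′}
compSum_{non-empty sets of 𝐃_k-domains with closure Z′} Π innerSum` (the (2.26)-weights `α₆ε₂e^{−(1−3δ)κd_k(Y)}`,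
`e^{−(a/2)|P|}` summed over Y₀ ⊆ Z₀-component, available P covering Z₀∖Y₀, covering families 𝐃 of Y₀ — all index
sets CONCRETE: `J`, `I`, `wZ`, `cc`, `closureDom`, `touch`, `avail`, `cellsOf`) — `hrep`, the analytic input
(2.15)–(2.26) being by assertion in print — THEN `B13.Bound238With W.toStepData c ℓ`: ‖H(Z)‖ ≤ C₃ε₁e^{−(1−8δ)ℓκd_{k+1}(Z)},
GIVEN ONLY the restrictions on the constants: signs, R15 `c.R15`, R16 as `17(1−4δ)κ ≤ a/20` and `4κ ≤ a/20`
(a = γ₂ε₁²/g_k²), R17 `e^{−a/20} ≤ ε₂`, (2.31) `8M⁴e^{−a/10} ≤ a/20`, the (2.29)/(1.26) thresholds at both scales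
(`κ₀(64,8) + a₂ ≤ δκ`, `α₆e^{a₂}K₀(64,8)·64 ≤ a₂`, likewise at the rate δℓκ), `64e^{−a/20} ≤ δκ`, R18
`B13Step237.R18half/R18sharp` at A = K₀(64,8)·exp(64e^{−a/20}), R20 as `17(1−7δ)ℓκ ≤ ½(κ₁−1)`, R21 as
`a₅ + e^{−½(κ₁−1)} ≤ Aabs`, `64·Aabs ≤ δℓκ`, and the absorption `(bracketF/α₆)·e^{64 Aabs} ≤ C₃ε₁` of the honest
constants into the O(1) of C₃.  Discharged inside: `hne`, `htouch`, `havail`, `h229`, `h2732`, `h230`, `hvol`, `hanch`,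
`hLfac`, `h126`, `hcc`, `h227'`, `h229'`, `h232`, `hvol1`, `hw`, `hws` of `B13Lemma3Assembly.bound238With_of_226`.
[cite: Balaban1988RG2Cluster, Lemma 3 (2.38) p.20] -/
theorem bound238With_window (c : B13.Consts) (hL0 : 0 < c.L) {Bk Bk1 : Finset (Pt 4)}
    (hB : closureIdx c.L (collar Bk) ⊆ Bk1) (W : TwoWindowStep Bk Bk1) (M : ℕ) {ℓ a a₂ a₂' a₅ Aabs : ℝ}
    (hrep : ∀ (Z : Dom Bk1) (φ : W.Φ), φ ∈ W.sp2 Z → ‖W.H Z φ‖ ≤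
      Real.exp (a₅ * ((cellsOf Bk1 Z.1).card : ℝ)) *
      ∑ j : J Z, Real.exp (-((c.κ₁ - 1) * ((wZ Z j).card : ℝ))) *
        ∏ i : I Z j, famSum (B13FamilySum.coveringFamilies (Finset.univ : Finset (Dom Bk1))
            (fun Z' : Dom Bk1 => cellsOf Bk1 Z'.1) (cc Z j i))
          (fun Z' => compSum (Finset.univ.filter fun Zc : Dom Bk => closureDom hL0 hB Zc = Z')
            (fun Zc => innerSum (Finset.univ : Finset (Dom Bk)) (fun Y : Dom Bk => cellsOf Bk Y.1)
              (sys Bk).dj (cellsOf Bk Zc.1) (touch M Bk) (avail M Bk Zc)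
              (c.α₆ * c.eps2) ((1 - 3 * c.δ) * c.κ) a)))
    (h236 : B13.Ineq236With (sys Bk) (sys Bk1) (closureDom hL0 hB) ℓ) (hℓ : 0 ≤ ℓ)
    (hα₆ : 0 < c.α₆) (hε₀ : 0 ≤ c.eps2) (hδ : 0 ≤ c.δ) (hδ7 : 0 ≤ 1 - 7 * c.δ) (hκ : 0 ≤ c.κ) (ha : 0 ≤ a)
    (hR15 : c.R15) (hR16 : 17 * ((1 - 4 * c.δ) * c.κ) ≤ a / 20) (hR16' : 4 * c.κ ≤ a / 20)
    (hR17 : Real.exp (-(a / 20)) ≤ c.eps2) (h231 : 2 * (4 : ℝ) * (M : ℝ) ^ 4 * Real.exp (-(a / 10)) ≤ a / 20)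
    (ha₂ : 0 ≤ a₂) (hκ229 : kappa₀ 64 8 + a₂ ≤ c.δ * c.κ)
    (hsm229 : c.α₆ * Real.exp a₂ * K₀ 64 8 * 64 ≤ a₂)
    (habsk : Real.exp (-(a / 20)) * 64 ≤ c.δ * c.κ)
    (h18half : B13Step237.R18half c (K₀ 64 8 * Real.exp (Real.exp (-(a / 20)) * 64)))
    (h18 : B13Step237.R18sharp c (K₀ 64 8 * Real.exp (Real.exp (-(a / 20)) * 64)) ℓ)
    (ha₂' : 0 ≤ a₂') (hκ229' : kappa₀ 64 8 + a₂' ≤ c.δ * ℓ * c.κ)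
    (hsm229' : c.α₆ * Real.exp a₂' * K₀ 64 8 * 64 ≤ a₂')
    (hR20 : 17 * ((1 - 7 * c.δ) * ℓ * c.κ) ≤ (c.κ₁ - 1) / 2)
    (ha₅ : 0 ≤ a₅) (habs : a₅ + Real.exp (-((c.κ₁ - 1) / 2)) ≤ Aabs) (hAc : Aabs * 64 ≤ c.δ * ℓ * c.κ)
    (hC3 : B13Step237.bracketF c (K₀ 64 8 * Real.exp (Real.exp (-(a / 20)) * 64)) / c.α₆ *
      Real.exp (Aabs * 64) ≤ c.C3act * c.ε₁) :
    B13.Bound238With W.toStepData c ℓ := by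
  have h64 : (4 : ℝ) * 2 ^ 4 = 64 := by norm_num
  have hK : K₀ (4 * 2 ^ 4) (2 * 4) = K₀ 64 8 := by norm_num
  have hκ₀ : kappa₀ (4 * 2 ^ 4) (2 * 4) = kappa₀ 64 8 := by norm_num
  -- scale k: volume law, (1.26) at the rate δκ, (2.29)
  have hvol : B13FamilySum.VolBound (Finset.univ : Finset (Dom Bk)) (fun Y : Dom Bk => cellsOf Bk Y.1)
      (sys Bk).dj 64 := by
    have h := hvol_window Bk
    rwa [h64] at h
  have h126 : B13FamilySum.Ineq126 (Finset.univ : Finset (Dom Bk)) (fun Y : Dom Bk => cellsOf Bk Y.1)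
      (sys Bk).dj (c.δ * c.κ) (K₀ 64 8) := by
    have hr : kappa₀ (4 * 2 ^ 4) (2 * 4) ≤ c.δ * c.κ := by rw [hκ₀]; linarith
    have h := h126_window Bk hr
    rwa [hK] at h
  have h229 : B13FamilySum.Ineq229 (Finset.univ : Finset (Dom Bk)) (fun Y : Dom Bk => cellsOf Bk Y.1)
      (sys Bk).dj c.α₆ (c.δ * c.κ) :=
    TreeLengthCubeSystem.ineq229_treeLen Bk c.δ c.κ c.α₆ a₂ hα₆.le ha₂ (by rw [hκ₀]; exact hκ229)
      (by rw [hK, h64]; exact hsm229)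
  -- scale k + 1: (2.29) at the rate δℓκ, volume law
  have h229' : B13FamilySum.Ineq229 (Finset.univ : Finset (Dom Bk1)) (fun Y : Dom Bk1 => cellsOf Bk1 Y.1)
      (sys Bk1).dj c.α₆ (c.δ * ℓ * c.κ) :=
    TreeLengthCubeSystem.ineq229_treeLen Bk1 (c.δ * ℓ) c.κ c.α₆ a₂' hα₆.le ha₂' (by rw [hκ₀]; exact hκ229')
      (by rw [hK, h64]; exact hsm229')
  have hvol1 : ∀ Z : Dom Bk1, ((cellsOf Bk1 Z.1).card : ℝ) ≤ 64 * (1 + (sys Bk1).dj Z) := by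
    intro Z
    have h := hvol1_window Z
    rwa [h64] at h
  exact B13Lemma3Assembly.bound238With_of_226 W.toStepData c ℓ
    (Cube := Cell Bk) (Bond := LBond 4) (α := Cell Bk1)
    (fun Y : Dom Bk => cellsOf Bk Y.1) (touch M Bk) (avail M Bk) (closureDom hL0 hB) (anchor c.L Bk)
    (fun Z => J Z) (fun Z j => I Z j) (fun Z j i => dI Z j i) (fun Z : Dom Bk1 => cellsOf Bk1 Z.1)
    (fun Z j => wZ Z j) (fun Z => wZ_injective Z) (fun Z j => wZ_subset Z j)
    (fun Z' : Dom Bk1 => cellsOf Bk1 Z'.1) (fun Z j i => cc Z j i)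
    (M4 := 2 * (4 : ℝ) * (M : ℝ) ^ 4) (c₃₂ := 17) (c₁ := 64) (K₁ := K₀ 64 8) (c₃₂' := 17) (c₁' := 64)
    hrep hα₆ hε₀ hδ hδ7 hκ hℓ ha (K₀_pos _ _).le
    cellsOf_nonempty hR15 hR16 hR16' hR17 h231 (card_touch_le M Bk)
    (fun Zc Y₀ _ => by have h := card_avail_le M Bk Zc Y₀; push_cast at h ⊢; exact h)
    h229 (fun Zc Y₀ hY₀ D hD hDne => B13Lemma3AssemblyWindow.h2732_window Bk Zc Y₀ hY₀ D hD hDne)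
    h230_window hvol habsk h236 (hanch_window hL0 hB) (fun Z' => card_anchor_le c.L Bk Z') h126 h18half h18
    cc_nonempty h227'_window h229' (fun Z j => h232_window Z j) hR20 ha₅ habs hvol1 hAc hC3

open Classical in
/-- **(2.38) AS PRINTED on the two-scale window model, from (2.26) and numbers only.**  Lemma 3 p. 20, verbatim:
*"Under all the above restrictions on the constants M, κ, κ₁, α₀, α₁, α₄, α₆, γ₂, γ, ε₁, the activity H(Z) for a
localization domain Z ∈ 𝐃_{k+1} satisfies the inequality |H(Z)| ≦ C₃ε₁ exp(−(1 − 8δ)½Lκd_{k+1}(Z)). (2.38)"*  At the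
printed transfer factor ℓ = ½L with L ≥ 8, (2.36) being the THEOREM `B13Geometry236Printed.ineq236Printed_window`:
`B13.Bound238 W.toStepData c` from `hrep` (the (2.26)-majorant over the concrete index sets) and the restrictions on
the constants (as in `bound238With_window`, at ℓ = ½L; R20 reads *"½(κ₁ − 1) ≧ 2Lκ"* up to the constants 17/(1−7δ)).
[cite: Balaban1988RG2Cluster, Lemma 3 (2.38) p.20] -/
theorem bound238_window (c : B13.Consts) (hL : 8 ≤ c.L) {Bk Bk1 : Finset (Pt 4)}
    (hB : closureIdx c.L (collar Bk) ⊆ Bk1) (W : TwoWindowStep Bk Bk1) (M : ℕ) {a a₂ a₂' a₅ Aabs : ℝ}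
    (hrep : ∀ (Z : Dom Bk1) (φ : W.Φ), φ ∈ W.sp2 Z → ‖W.H Z φ‖ ≤
      Real.exp (a₅ * ((cellsOf Bk1 Z.1).card : ℝ)) *
      ∑ j : J Z, Real.exp (-((c.κ₁ - 1) * ((wZ Z j).card : ℝ))) *
        ∏ i : I Z j, famSum (B13FamilySum.coveringFamilies (Finset.univ : Finset (Dom Bk1))
            (fun Z' : Dom Bk1 => cellsOf Bk1 Z'.1) (cc Z j i))
          (fun Z' => compSum (Finset.univ.filter fun Zc : Dom Bk =>
              closureDom (by omega : 0 < c.L) hB Zc = Z')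
            (fun Zc => innerSum (Finset.univ : Finset (Dom Bk)) (fun Y : Dom Bk => cellsOf Bk Y.1)
              (sys Bk).dj (cellsOf Bk Zc.1) (touch M Bk) (avail M Bk Zc)
              (c.α₆ * c.eps2) ((1 - 3 * c.δ) * c.κ) a)))
    (hα₆ : 0 < c.α₆) (hε₀ : 0 ≤ c.eps2) (hδ : 0 ≤ c.δ) (hδ7 : 0 ≤ 1 - 7 * c.δ) (hκ : 0 ≤ c.κ) (ha : 0 ≤ a)
    (hR15 : c.R15) (hR16 : 17 * ((1 - 4 * c.δ) * c.κ) ≤ a / 20) (hR16' : 4 * c.κ ≤ a / 20)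
    (hR17 : Real.exp (-(a / 20)) ≤ c.eps2) (h231 : 2 * (4 : ℝ) * (M : ℝ) ^ 4 * Real.exp (-(a / 10)) ≤ a / 20)
    (ha₂ : 0 ≤ a₂) (hκ229 : kappa₀ 64 8 + a₂ ≤ c.δ * c.κ)
    (hsm229 : c.α₆ * Real.exp a₂ * K₀ 64 8 * 64 ≤ a₂)
    (habsk : Real.exp (-(a / 20)) * 64 ≤ c.δ * c.κ)
    (h18half : B13Step237.R18half c (K₀ 64 8 * Real.exp (Real.exp (-(a / 20)) * 64)))
    (h18 : B13Step237.R18sharp c (K₀ 64 8 * Real.exp (Real.exp (-(a / 20)) * 64)) ((c.L : ℝ) / 2))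
    (ha₂' : 0 ≤ a₂') (hκ229' : kappa₀ 64 8 + a₂' ≤ c.δ * ((c.L : ℝ) / 2) * c.κ)
    (hsm229' : c.α₆ * Real.exp a₂' * K₀ 64 8 * 64 ≤ a₂')
    (hR20 : 17 * ((1 - 7 * c.δ) * ((c.L : ℝ) / 2) * c.κ) ≤ (c.κ₁ - 1) / 2)
    (ha₅ : 0 ≤ a₅) (habs : a₅ + Real.exp (-((c.κ₁ - 1) / 2)) ≤ Aabs)
    (hAc : Aabs * 64 ≤ c.δ * ((c.L : ℝ) / 2) * c.κ)
    (hC3 : B13Step237.bracketF c (K₀ 64 8 * Real.exp (Real.exp (-(a / 20)) * 64)) / c.α₆ *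
      Real.exp (Aabs * 64) ≤ c.C3act * c.ε₁) :
    B13.Bound238 W.toStepData c := by
  rw [← B13.bound238With_half]
  exact bound238With_window c (by omega) hB W M hrep (B13Geometry236Printed.ineq236Printed_window hL hB)
    (by positivity) hα₆ hε₀ hδ hδ7 hκ ha hR15 hR16 hR16' hR17 h231 ha₂ hκ229 hsm229 habsk h18half h18 ha₂' hκ229'
    hsm229' hR20 ha₅ habs hAc hC3

/-- Hence the statement row **Lemma 3 AS PRINTED**, `B13.Lemma3Printed W.toStepData c` (:= `Restr → Bound238`), on
the two-scale window model from (2.26) and numbers — the restrictions having been consumed as the explicit numerical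
hypotheses of `bound238_window`. [cite: Balaban1988RG2Cluster, Lemma 3 p.20] -/
theorem lemma3Printed_window {Bk Bk1 : Finset (Pt 4)} (W : TwoWindowStep Bk Bk1) (c : B13.Consts)
    (h : B13.Bound238 W.toStepData c) : B13.Lemma3Printed W.toStepData c := fun _ => h

open Classical in
/-- The same at the kernel-certified transfer factor ℓ = L / a236c(L) for every L ≥ 3 ((2.36) in the form
`B13Geometry236Printed.ineq236With_window_centre`, a236c(L) = 3/2 + 3/(L − 2); transfer factor 22/3 at L = 13):
`B13.Bound238With W.toStepData c (L / a236c L)` from `hrep` and the restrictions at that ℓ. [cite: Balaban1988RG2Cluster, (2.36)–(2.38) pp.19–20] -/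
theorem bound238With_window_centre (c : B13.Consts) (hL : 3 ≤ c.L) {Bk Bk1 : Finset (Pt 4)}
    (hB : closureIdx c.L (collar Bk) ⊆ Bk1) (W : TwoWindowStep Bk Bk1) (M : ℕ) {a a₂ a₂' a₅ Aabs : ℝ}
    (hrep : ∀ (Z : Dom Bk1) (φ : W.Φ), φ ∈ W.sp2 Z → ‖W.H Z φ‖ ≤
      Real.exp (a₅ * ((cellsOf Bk1 Z.1).card : ℝ)) *
      ∑ j : J Z, Real.exp (-((c.κ₁ - 1) * ((wZ Z j).card : ℝ))) *
        ∏ i : I Z j, famSum (B13FamilySum.coveringFamilies (Finset.univ : Finset (Dom Bk1))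
            (fun Z' : Dom Bk1 => cellsOf Bk1 Z'.1) (cc Z j i))
          (fun Z' => compSum (Finset.univ.filter fun Zc : Dom Bk =>
              closureDom (by omega : 0 < c.L) hB Zc = Z')
            (fun Zc => innerSum (Finset.univ : Finset (Dom Bk)) (fun Y : Dom Bk => cellsOf Bk Y.1)
              (sys Bk).dj (cellsOf Bk Zc.1) (touch M Bk) (avail M Bk Zc)
              (c.α₆ * c.eps2) ((1 - 3 * c.δ) * c.κ) a)))
    (hα₆ : 0 < c.α₆) (hε₀ : 0 ≤ c.eps2) (hδ : 0 ≤ c.δ) (hδ7 : 0 ≤ 1 - 7 * c.δ) (hκ : 0 ≤ c.κ) (ha : 0 ≤ a)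
    (hR15 : c.R15) (hR16 : 17 * ((1 - 4 * c.δ) * c.κ) ≤ a / 20) (hR16' : 4 * c.κ ≤ a / 20)
    (hR17 : Real.exp (-(a / 20)) ≤ c.eps2) (h231 : 2 * (4 : ℝ) * (M : ℝ) ^ 4 * Real.exp (-(a / 10)) ≤ a / 20)
    (ha₂ : 0 ≤ a₂) (hκ229 : kappa₀ 64 8 + a₂ ≤ c.δ * c.κ)
    (hsm229 : c.α₆ * Real.exp a₂ * K₀ 64 8 * 64 ≤ a₂)
    (habsk : Real.exp (-(a / 20)) * 64 ≤ c.δ * c.κ)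
    (h18half : B13Step237.R18half c (K₀ 64 8 * Real.exp (Real.exp (-(a / 20)) * 64)))
    (h18 : B13Step237.R18sharp c (K₀ 64 8 * Real.exp (Real.exp (-(a / 20)) * 64)) ((c.L : ℝ) / a236c c.L))
    (ha₂' : 0 ≤ a₂') (hκ229' : kappa₀ 64 8 + a₂' ≤ c.δ * ((c.L : ℝ) / a236c c.L) * c.κ)
    (hsm229' : c.α₆ * Real.exp a₂' * K₀ 64 8 * 64 ≤ a₂')
    (hR20 : 17 * ((1 - 7 * c.δ) * ((c.L : ℝ) / a236c c.L) * c.κ) ≤ (c.κ₁ - 1) / 2)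
    (ha₅ : 0 ≤ a₅) (habs : a₅ + Real.exp (-((c.κ₁ - 1) / 2)) ≤ Aabs)
    (hAc : Aabs * 64 ≤ c.δ * ((c.L : ℝ) / a236c c.L) * c.κ)
    (hC3 : B13Step237.bracketF c (K₀ 64 8 * Real.exp (Real.exp (-(a / 20)) * 64)) / c.α₆ *
      Real.exp (Aabs * 64) ≤ c.C3act * c.ε₁) :
    B13.Bound238With W.toStepData c ((c.L : ℝ) / a236c c.L) := by
  have hL3 : (3 : ℝ) ≤ (c.L : ℝ) := by exact_mod_cast hL
  have hℓ : 0 ≤ (c.L : ℝ) / a236c c.L :=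
    div_nonneg (by linarith) (a236c_pos (by linarith)).le
  exact bound238With_window c (by omega) hB W M hrep (B13Geometry236Printed.ineq236With_window_centre hL hB) hℓ
    hα₆ hε₀ hδ hδ7 hκ ha hR15 hR16 hR16' hR17 h231 ha₂ hκ229 hsm229 habsk h18half h18 ha₂' hκ229' hsm229' hR20 ha₅
    habs hAc hC3

end

end Literature.MathematicalPhysics.QuantumFieldTheory.Balaban1983to89.B13Lemma3Window
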